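import Literature.Analysis.FluidPDE.NSCriticalClosureBesovBounded
import Literature.Analysis.FluidPDE.TaoH1MildProofs
import HarnessLib

/-!
# The critical Besov continuation criterion: the dependency record after Tao's Cor. 4.3

Analysis/FluidPDE assembly file (proof only) for the named fact
`Literature.Analysis.FluidPDE.hasSmoothExtensionPast_of_eHomBesovNorm_bounded`
(Gallagher–Koch–Planchon 2016, Thm. 1, contrapositive for classical Leray–Hopf solutions from
rapidly decaying data). `NSCriticalClosureBesovBounded.lean` reduces it to five named facts
(`hasSmoothExtensionPast_of_eHomBesovNorm_bounded_of_and`); one of them, Tao 2013, Cor. 4.3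
(`tao2011_isMildNSSolutionOn_of_memSobolevX`), has meanwhile been discharged
(`tao2011_isMildNSSolutionOn_of_memSobolevX_holds`, `TaoH1MildProofs.lean`). This file feeds
that discharge in, so that the dependency record of the fact now lists the **four** remaining
named facts:

* `gkp_besov_blowup` — GKP 2016, Thm. 1 (profile decompositions, critical element, rigidity);
* `tao2011_hasBoundedSobolevNormsOn` — Tao 2013, Cor. 11.1 with Cor. 4.3 and Thm. 5.4 (iv);
* `tao2011_smooth_local_existence` — Tao 2013, Thm. 5.4 (ii)+(iv);
* `knss_classical_of_bounded_isBesovMildSolutionOn` — KNSS 2009, §4 (decomposed further in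
  `NSBoundedMildOseen.lean`).

Kept in a separate file so that the heavier proof imports of `TaoH1MildProofs` stay out of the
statement/assembly file imported by `NSBoundedMildOseen.lean`.

## References

* I. Gallagher, G. S. Koch, F. Planchon, Comm. Math. Phys. 343 (2016) 39–82 = arXiv:1407.4156,
  Thm. 1 (p. 5), §2.1 (p. 6). [GKP2016]
* T. Tao, Anal. PDE 6 (2013) 25–107 = arXiv:1108.1165, Cor. 4.3, Cor. 11.1, Thm. 5.4. [Tao2011]
* G. Koch, N. Nadirashvili, G. Seregin, V. Šverák, Acta Math. 203 (2009) 83–105, §4.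
  [KochNadirashviliSereginSverak2009]
-/

noncomputable section

namespace Literature.Analysis.FluidPDE

/-- **The critical Besov continuation criterion from the four remaining named facts** (GKP 2016,
Thm. 1, contrapositive; the identification steps through Tao 2013 and the KNSS smoothing of
bounded Besov mild solutions): `hasSmoothExtensionPast_of_eHomBesovNorm_bounded_of_gkp_knss` with
Tao's Cor. 4.3 supplied by its discharge `tao2011_isMildNSSolutionOn_of_memSobolevX_holds`. [cite: GKP2016, Thm. 1] -/
theorem hasSmoothExtensionPast_of_eHomBesovNorm_bounded_of_gkp_tao_knss (hG : gkp_besov_blowup)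
    (h₁ : tao2011_hasBoundedSobolevNormsOn) (hTao : tao2011_smooth_local_existence)
    (hK : knss_classical_of_bounded_isBesovMildSolutionOn) :
    hasSmoothExtensionPast_of_eHomBesovNorm_bounded :=
  hasSmoothExtensionPast_of_eHomBesovNorm_bounded_of_gkp_knss hG h₁
    tao2011_isMildNSSolutionOn_of_memSobolevX_holds hTao hK

/-- **The route's dependency record, updated**: `hasSmoothExtensionPast_of_eHomBesovNorm_bounded`
holds as soon as the four remaining named facts are discharged (GKP Thm. 1, two Tao 2013 facts,
the KNSS smoothing fact); stated as the implication from their conjunction. [cite: GKP2016, Thm. 1] -/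
theorem hasSmoothExtensionPast_of_eHomBesovNorm_bounded_of_and4
    (h : gkp_besov_blowup ∧ tao2011_hasBoundedSobolevNormsOn ∧ tao2011_smooth_local_existence ∧
      knss_classical_of_bounded_isBesovMildSolutionOn) :
    hasSmoothExtensionPast_of_eHomBesovNorm_bounded :=
  hasSmoothExtensionPast_of_eHomBesovNorm_bounded_of_gkp_tao_knss h.1 h.2.1 h.2.2.1 h.2.2.2

end Literature.Analysis.FluidPDE

end
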